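import Summits.HodgeConjecture.HodgeConjecture.Theorems.MarkmanPartnerTransportPartnerExistenceLattice
import Summits.HodgeConjecture.HodgeConjecture.Theorems.MarkmanPartnerTransportPartnerExistenceSignatureReal
import Literature.NumberTheory.QuadraticForms.RepresentationCodimThree

/-!
# Route MarkmanPartnerTransport · support `PartnerExistence` (stmt-HodgeConjecture-19655) —
# `T(X)_ℚ` embeds isometrically into `Λ_{K3} ⊗ ℚ` when `ρ(X) ≥ 4` (Hasse–Minkowski step)

For a marked smooth projective fourfold `(X, φ, P, z)` with rational Néron–Severi space `N_ℚ`
(`…PartnerExistenceLattice`) and rational transcendental space `T_ℚ = N_ℚ^⊥ ⊂ ℚ²³` (regular, of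
dimension `23 − ρ(X)`), the rational quadratic space `(T_ℚ, q)` embeds isometrically into the rational
K3 quadratic space `(ℚ²², k3FormRat)` as soon as `ρ(X) ≥ 4` — the tree's PROVED Hasse–Minkowski /
Kitaoka Cor. 4.1.4 criterion `exists_isometry_of_sigPos_le_of_sigNeg_le_of_finrank_add_three_le`
(codimension `(22) − (23 − ρ) ≥ 3`, `ind⁺ T_ℚ ≤ ind⁺ ℚ²³ ≤ 3 ≤ ind⁺ Λ_ℚ`,
`ind⁻ T_ℚ ≤ dim T_ℚ ≤ 19 ≤ ind⁻ Λ_ℚ`).  The signature bounds are proved by hand from the block forms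
`Λ_{K3} = E₈(−1)² ⊕ U³`, `Λ₂₃ = Λ_{K3} ⊕ ⟨−2⟩` over `ℝ` (`AnchorExistenceCMFloor.k3FormR_self_of_mem_ker`,
`PartnerExistenceSignature.k3HilbertFormR_self_of_mem_negSpace`): the kernels of three explicit
functionals are non-positive `20`- resp. negative definite `19`-spaces, the `U³`-diagonal is a positive
definite `3`-space.

* `sigPos_restrict_le` — `ind⁺` of a restriction is at most `ind⁺` (generic);
* `qQ_realCast`, `k3FormRat_realCast` — `ℚ ⊂ ℝ` for the two forms;
* `sigPos_qQ_le_three`, `three_le_sigPos_k3FormRat`, `nineteen_le_sigNeg_k3FormRat`;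
* `exists_isometry_ratTransc` — **the embedding `(T_ℚ, q) ↪ (ℚ²², k3FormRat)` for `ρ(X) ≥ 4`**;
* `isometry_bilinear` — an isometry of the quadratic forms preserves the bilinear forms (polarisation).

No definition, no sorry, no named fact. Prover seat hodge-nonav-19652-p1 (gen 5), `--supports stmt-HodgeConjecture-19655`.

References: Y. Kitaoka, *Arithmetic of Quadratic Forms*, Cor. 4.1.4; O. T. O'Meara, *Introduction to
Quadratic Forms*, 61:1, 66:3; D. Huybrechts, *Lectures on K3 Surfaces*, Ch. 1 Prop. 3.5 and Ch. 14 §0.3;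
D. Morrison, Invent. Math. 75 (1984) §1–2 (the embedding `T ↪ Λ_{K3}`).
-/

noncomputable section

set_option linter.dupNamespace false

open Module CategoryTheory QuadraticMap
open Literature.AlgebraicTopology.SingularHomology Literature.Geometry.Kaehler
open Literature.AlgebraicGeometry Literature.AlgebraicGeometry.Motives Literature.AlgebraicGeometry.HodgeTheory
open Literature.AlgebraicGeometry.Hyperkaehler Literature.AlgebraicGeometry.Surfaces
open Literature.NumberTheory.QuadraticForms
open Summit.HodgeConjecture.HodgeConjecture.Theorems.NikulinTwinTransport
open Summit.HodgeConjecture.HodgeConjecture.Theorems.AnchorExistenceCMFloor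
open Summit.HodgeConjecture.HodgeConjecture.Theorems.MarkmanPartnerTransport.PartnerExistenceSignature

namespace Summit.HodgeConjecture.HodgeConjecture.Theorems.MarkmanPartnerTransport.PartnerLattice

variable {X : SchemeOver ℂ}

/-- `MarkedK3Sq[X, φ, P, z]`: VERBATIM the `let MarkedK3Sq := …` binder of the route declarations of
MarkmanPartnerTransport (clauses (m1)–(m6)). Local notation only. -/
local notation3 (prettyPrint := false) "MarkedK3Sq[" X ", " φ ", " P ", " z "]" =>
  (((IsIntegralClass P ∧ ∀ Q : complexBetti X (2 * 4), IsIntegralClass Q → ∃ n : ℤ, Q = n • P) ∧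
    (∀ c : complexBetti X 2, IsIntegralClass c ↔ ∃ v : K3HilbertIndex → ℤ, φ c = fun i => (v i : ℂ)) ∧
    (∀ a : complexBetti X 2, cupPowTwo a 4 = ((3 : ℂ) * (k3HilbertForm 2 (φ a) (φ a)) ^ 2) • P) ∧
    (IsOfHodgeType 4 X 2 2 0 (LinearEquiv.symm φ z) ∧
      ∀ τ : complexBetti X 2, IsOfHodgeType 4 X 2 2 0 τ → ∃ t : ℂ, τ = t • LinearEquiv.symm φ z) ∧
    (∀ c : complexBetti X 2, IsOfHodgeType 4 X 2 1 1 c ↔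
      (k3HilbertForm 2 (φ c) z = 0 ∧ k3HilbertForm 2 (φ c) (star z) = 0)) ∧
    (k3HilbertForm 2 z z = 0 ∧ 0 < (k3HilbertForm 2 (star z) z).re)))

/-- `qQ` = the rational Beauville–Bogomolov form of `K3^{[2]}`-type on `ℚ²³`. Local notation only. -/
local notation3 (prettyPrint := false) "qQ" => Matrix.toBilin' (Matrix.map (k3HilbertGram 2) (Int.cast : ℤ → ℚ))

/-- `qR` = the real Beauville–Bogomolov form of `K3^{[2]}`-type on `ℝ²³`. Local notation only. -/
local notation3 (prettyPrint := false) "qR" => Matrix.toBilin' (Matrix.map (k3HilbertGram 2) (Int.cast : ℤ → ℝ))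

/-- `NΛ'` = the negative definite real `20`-space of `…PartnerExistenceSignatureReal`. Local notation only. -/
local notation3 (prettyPrint := false) "NΛ'" => LinearMap.ker (negMap ∘ₗ LinearMap.funLeft ℝ ℝ (Sum.inl : K3Index → K3HilbertIndex))

/-! ### Generic: the positive index of a restriction -/

/-- **`ind⁺(Q|_W) ≤ ind⁺(Q)`**: a positive definite subspace of `W` is one of the ambient space.
[cite: Omeara1963, §61 (61:1)] -/
theorem sigPos_restrict_le {V : Type*} [AddCommGroup V] [Module ℚ V] [FiniteDimensional ℚ V]
    (Q : QuadraticForm ℚ V) (W : Submodule ℚ V) : sigPos (Q.restrict W) ≤ sigPos Q := by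
  obtain ⟨U, hU, hpos⟩ := exists_finrank_eq_sigPos_and_posDef (Q.restrict W)
  have h1 : finrank ℚ (U.map W.subtype) = finrank ℚ U :=
    LinearEquiv.finrank_eq (Submodule.equivMapOfInjective _ W.injective_subtype U).symm
  have hpos' : (Q.restrict (U.map W.subtype)).PosDef := by
    rintro ⟨x, hx⟩ hx0
    obtain ⟨u, hu, rfl⟩ := Submodule.mem_map.1 hx
    have hu0 : (⟨u, hu⟩ : U) ≠ 0 := by
      intro h
      apply hx0
      have h' : u = 0 := by simpa using congrArg (fun r : U => (r : W)) h
      simp [h']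
    have h2 := hpos ⟨u, hu⟩ hu0
    simpa [QuadraticMap.restrict_apply] using h2
  rw [← hU, ← h1]
  exact le_sigPos_of_posDef Q hpos'

/-- The quadratic form of a restricted bilinear form is the restricted quadratic form. [folklore] -/
theorem toQuadraticMap_restrict {V : Type*} [AddCommGroup V] [Module ℚ V] (B : LinearMap.BilinForm ℚ V)
    (W : Submodule ℚ V) : (B.restrict W).toQuadraticMap = B.toQuadraticMap.restrict W := by
  ext w
  rfl

/-! ### `ℚ ⊂ ℝ` for the two forms -/

/-- The rational `K3^{[2]}` form cast to `ℝ` is the real one. [folklore] -/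
theorem qQ_realCast (a b : K3HilbertIndex → ℚ) :
    ((qQ a b : ℚ) : ℝ) = qR (fun i => (a i : ℝ)) (fun i => (b i : ℝ)) := by
  rw [Matrix.toBilin'_apply, Matrix.toBilin'_apply]
  simp only [Matrix.map_apply, Rat.cast_sum, Rat.cast_mul, Rat.cast_intCast]

/-- The rational K3 form cast to `ℝ` is the real one. [folklore] -/
theorem k3FormRat_realCast (a b : K3Index → ℚ) :
    ((k3FormRat a b : ℚ) : ℝ) = k3FormR (fun i => (a i : ℝ)) (fun i => (b i : ℝ)) := by
  rw [k3FormRat_apply, k3FormR_apply]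
  simp only [Rat.cast_sum, Rat.cast_mul, Rat.cast_intCast]

/-- A rational vector with zero real cast is zero. [folklore] -/
theorem eq_zero_of_realCast_eq_zero {ι : Type*} {v : ι → ℚ} (h : (fun i => (v i : ℝ)) = 0) : v = 0 := by
  funext i
  have hi := congrFun h i
  simp only [Pi.zero_apply, Rat.cast_eq_zero] at hi
  exact hi

/-! ### `ind⁺(ℚ²³, q) ≤ 3` -/

/-- **`ind⁺ (Λ₂₃ ⊗ ℚ) ≤ 3`**: the kernel of `v ↦ (v_{a₀}+v_{a₁}, v_{b₀}+v_{b₁}, v_{c₀}+v_{c₁})` is a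
`20`-dimensional subspace on which `q ≤ 0` (its real points lie in the negative definite `20`-space
`NΛ'`), and `ind⁺ + 20 ≤ 23` (`sigPos_add_finrank_le_of_nonpos`). [cite: Beauville1983, §8 Thm. 5 (a)]
[cite: Huybrechts2016K3, Ch. 14 §0.3 (vi)] -/
theorem sigPos_qQ_le_three : sigPos (qQ).toQuadraticMap ≤ 3 := by
  let pr : K3HilbertIndex → ((K3HilbertIndex → ℚ) →ₗ[ℚ] ℚ) := fun i => LinearMap.proj i
  let ℓ : Fin 3 → ((K3HilbertIndex → ℚ) →ₗ[ℚ] ℚ) :=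
    ![pr (Sum.inl (Sum.inr (Sum.inl 0))) + pr (Sum.inl (Sum.inr (Sum.inl 1))),
      pr (Sum.inl (Sum.inr (Sum.inr (Sum.inl 0)))) + pr (Sum.inl (Sum.inr (Sum.inr (Sum.inl 1)))),
      pr (Sum.inl (Sum.inr (Sum.inr (Sum.inr 0)))) + pr (Sum.inl (Sum.inr (Sum.inr (Sum.inr 1))))]
  let L : (K3HilbertIndex → ℚ) →ₗ[ℚ] (Fin 3 → ℚ) := LinearMap.pi ℓ
  have hker : 20 ≤ finrank ℚ (LinearMap.ker L) := by
    have h := LinearMap.finrank_range_add_finrank_ker L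
    have hr : finrank ℚ (LinearMap.range L) ≤ 3 := by
      have := Submodule.finrank_le (LinearMap.range L)
      rwa [finrank_fintype_fun_eq_card, Fintype.card_fin] at this
    rw [finrank_rat23] at h
    omega
  have hnonpos : ∀ v ∈ LinearMap.ker L, (qQ).toQuadraticMap v ≤ 0 := by
    intro v hv
    rw [LinearMap.BilinMap.toQuadraticMap_apply]
    have h0 : ∀ k, ℓ k v = 0 := fun k => by
      have := congrFun (LinearMap.mem_ker.1 hv) k
      rwa [LinearMap.pi_apply] at this
    have ha := h0 0
    have hb := h0 1
    have hc := h0 2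
    simp only [ℓ, pr, Matrix.cons_val_zero, Matrix.cons_val_one, Matrix.cons_val, LinearMap.add_apply,
      LinearMap.coe_proj, Function.eval] at ha hb hc
    have hmem : (fun i => (v i : ℝ)) ∈ NΛ' := by
      rw [mem_negSpace_iff, LinearMap.mem_ker]
      obtain ⟨e0, e1, e2⟩ := negMap_apply (fun i : K3Index => (v (Sum.inl i) : ℝ))
      have c0 : negMap (fun i : K3Index => (v (Sum.inl i) : ℝ)) 0 = 0 := by rw [e0]; exact_mod_cast ha
      have c1 : negMap (fun i : K3Index => (v (Sum.inl i) : ℝ)) 1 = 0 := by rw [e1]; exact_mod_cast hb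
      have c2 : negMap (fun i : K3Index => (v (Sum.inl i) : ℝ)) 2 = 0 := by rw [e2]; exact_mod_cast hc
      funext k
      fin_cases k
      · simpa using c0
      · simpa using c1
      · simpa using c2
    have hle := (k3HilbertFormR_self_of_mem_negSpace hmem).1
    rw [← qQ_realCast] at hle
    exact_mod_cast hle
  have h := QuadraticForm.sigPos_add_finrank_le_of_nonpos hnonpos
  rw [finrank_rat23] at h
  omega

/-! ### `3 ≤ ind⁺(Λ_ℚ)` and `19 ≤ ind⁻(Λ_ℚ)` -/

/-- **`3 ≤ ind⁺ (Λ_{K3} ⊗ ℚ)`**: the `U³`-diagonal `{E₈-coordinates 0, v_{k,0} = v_{k,1}}` is a positive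
definite `3`-space (`(v.v) = 2 Σₖ v_{k,0}²`). [cite: Huybrechts2016K3, Ch. 1 Prop. 3.5 and Ch. 14 §0.3 (vi)] -/
theorem three_le_sigPos_k3FormRat : 3 ≤ sigPos k3FormRat.toQuadraticMap := by
  let pr : K3Index → ((K3Index → ℚ) →ₗ[ℚ] ℚ) := fun i => LinearMap.proj i
  let f : (Fin 8 ⊕ Fin 8) → ((K3Index → ℚ) →ₗ[ℚ] ℚ) := fun e => pr (Sum.inl e)
  let g : Fin 3 → ((K3Index → ℚ) →ₗ[ℚ] ℚ) :=
    ![pr (Sum.inr (Sum.inl 0)) - pr (Sum.inr (Sum.inl 1)),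
      pr (Sum.inr (Sum.inr (Sum.inl 0))) - pr (Sum.inr (Sum.inr (Sum.inl 1))),
      pr (Sum.inr (Sum.inr (Sum.inr 0))) - pr (Sum.inr (Sum.inr (Sum.inr 1)))]
  let L : (K3Index → ℚ) →ₗ[ℚ] ((Fin 8 ⊕ Fin 8) ⊕ Fin 3 → ℚ) := LinearMap.pi (Sum.elim f g)
  have hker : 3 ≤ finrank ℚ (LinearMap.ker L) := by
    have h := LinearMap.finrank_range_add_finrank_ker L
    have hr : finrank ℚ (LinearMap.range L) ≤ 19 := by
      have := Submodule.finrank_le (LinearMap.range L)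
      rw [finrank_fintype_fun_eq_card] at this
      exact this
    rw [finrank_k3Rat] at h
    omega
  have hpos : (k3FormRat.toQuadraticMap.restrict (LinearMap.ker L)).PosDef := by
    rintro ⟨v, hv⟩ hv0
    rw [QuadraticMap.restrict_apply, LinearMap.BilinMap.toQuadraticMap_apply]
    have h0 : ∀ j, (Sum.elim f g) j v = 0 := fun j => by
      have := congrFun (LinearMap.mem_ker.1 hv) j
      rwa [LinearMap.pi_apply] at this
    have hE : ∀ e : Fin 8 ⊕ Fin 8, v (Sum.inl e) = 0 := fun e => by
      have := h0 (Sum.inl e)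
      simpa [f, pr] using this
    have ha := h0 (Sum.inr 0)
    have hb := h0 (Sum.inr 1)
    have hc := h0 (Sum.inr 2)
    simp only [Sum.elim_inr, g, pr, Matrix.cons_val_zero, Matrix.cons_val_one, Matrix.cons_val,
      LinearMap.sub_apply, LinearMap.coe_proj, Function.eval, sub_eq_zero] at ha hb hc
    -- the real computation
    have hR : k3FormR (fun i => (v i : ℝ)) (fun i => (v i : ℝ)) =
        2 * ((v (Sum.inr (Sum.inl 0)) : ℝ) ^ 2 + (v (Sum.inr (Sum.inr (Sum.inl 0))) : ℝ) ^ 2 +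
          (v (Sum.inr (Sum.inr (Sum.inr 0))) : ℝ) ^ 2) := by
      rw [k3FormR_self_eq]
      simp only [hE, ha, hb, hc, Rat.cast_zero, zero_mul, mul_zero, Finset.sum_const_zero, neg_zero,
        sub_zero, zero_add]
      ring
    have hv0' : ¬ (v (Sum.inr (Sum.inl 0)) = 0 ∧ v (Sum.inr (Sum.inr (Sum.inl 0))) = 0 ∧
        v (Sum.inr (Sum.inr (Sum.inr 0))) = 0) := by
      rintro ⟨h1, h2, h3⟩
      apply hv0
      ext i
      rcases i with (e | (k | (k | k)))
      · exact hE _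
      · fin_cases k
        · exact h1
        · simpa [h1] using ha.symm
      · fin_cases k
        · exact h2
        · simpa [h2] using hb.symm
      · fin_cases k
        · exact h3
        · simpa [h3] using hc.symm
    have hposR : 0 < k3FormR (fun i => (v i : ℝ)) (fun i => (v i : ℝ)) := by
      rw [hR]
      have : (0 : ℝ) < (v (Sum.inr (Sum.inl 0)) : ℝ) ^ 2 + (v (Sum.inr (Sum.inr (Sum.inl 0))) : ℝ) ^ 2 +
          (v (Sum.inr (Sum.inr (Sum.inr 0))) : ℝ) ^ 2 := by
        by_contra hle
        rw [not_lt] at hle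
        have s1 := sq_nonneg ((v (Sum.inr (Sum.inl 0)) : ℝ))
        have s2 := sq_nonneg ((v (Sum.inr (Sum.inr (Sum.inl 0))) : ℝ))
        have s3 := sq_nonneg ((v (Sum.inr (Sum.inr (Sum.inr 0))) : ℝ))
        have e1 : ((v (Sum.inr (Sum.inl 0)) : ℝ)) = 0 := by nlinarith
        have e2 : ((v (Sum.inr (Sum.inr (Sum.inl 0))) : ℝ)) = 0 := by nlinarith
        have e3 : ((v (Sum.inr (Sum.inr (Sum.inr 0))) : ℝ)) = 0 := by nlinarith
        exact hv0' ⟨by exact_mod_cast e1, by exact_mod_cast e2, by exact_mod_cast e3⟩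
      linarith
    rw [← k3FormRat_realCast] at hposR
    exact_mod_cast hposR
  calc 3 ≤ finrank ℚ (LinearMap.ker L) := hker
    _ ≤ sigPos k3FormRat.toQuadraticMap := le_sigPos_of_posDef _ hpos

/-- **`19 ≤ ind⁻ (Λ_{K3} ⊗ ℚ)`**: the kernel of `v ↦ (v_{a₀}+v_{a₁}, v_{b₀}+v_{b₁}, v_{c₀}+v_{c₁})` is a
negative definite subspace of dimension `≥ 19` (its real points lie in `ker negMap`,
`AnchorExistenceCMFloor.k3FormR_self_of_mem_ker`). [cite: Huybrechts2016K3, Ch. 1 Prop. 3.5 and Ch. 14 §0.3 (vi)] -/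
theorem nineteen_le_sigNeg_k3FormRat : 19 ≤ sigNeg k3FormRat.toQuadraticMap := by
  let pr : K3Index → ((K3Index → ℚ) →ₗ[ℚ] ℚ) := fun i => LinearMap.proj i
  let ℓ : Fin 3 → ((K3Index → ℚ) →ₗ[ℚ] ℚ) :=
    ![pr (Sum.inr (Sum.inl 0)) + pr (Sum.inr (Sum.inl 1)),
      pr (Sum.inr (Sum.inr (Sum.inl 0))) + pr (Sum.inr (Sum.inr (Sum.inl 1))),
      pr (Sum.inr (Sum.inr (Sum.inr 0))) + pr (Sum.inr (Sum.inr (Sum.inr 1)))]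
  let L : (K3Index → ℚ) →ₗ[ℚ] (Fin 3 → ℚ) := LinearMap.pi ℓ
  have hker : 19 ≤ finrank ℚ (LinearMap.ker L) := by
    have h := LinearMap.finrank_range_add_finrank_ker L
    have hr : finrank ℚ (LinearMap.range L) ≤ 3 := by
      have := Submodule.finrank_le (LinearMap.range L)
      rwa [finrank_fintype_fun_eq_card, Fintype.card_fin] at this
    rw [finrank_k3Rat] at h
    omega
  have hneg : ((-k3FormRat.toQuadraticMap).restrict (LinearMap.ker L)).PosDef := by
    rintro ⟨v, hv⟩ hv0
    rw [QuadraticMap.restrict_apply, QuadraticMap.neg_apply, LinearMap.BilinMap.toQuadraticMap_apply,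
      neg_pos]
    have h0 : ∀ k, ℓ k v = 0 := fun k => by
      have := congrFun (LinearMap.mem_ker.1 hv) k
      rwa [LinearMap.pi_apply] at this
    have ha := h0 0
    have hb := h0 1
    have hc := h0 2
    simp only [ℓ, pr, Matrix.cons_val_zero, Matrix.cons_val_one, Matrix.cons_val, LinearMap.add_apply,
      LinearMap.coe_proj, Function.eval] at ha hb hc
    have hmem : (fun i => (v i : ℝ)) ∈ LinearMap.ker negMap := by
      rw [LinearMap.mem_ker]
      obtain ⟨e0, e1, e2⟩ := negMap_apply (fun i : K3Index => (v i : ℝ))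
      have c0 : negMap (fun i : K3Index => (v i : ℝ)) 0 = 0 := by rw [e0]; exact_mod_cast ha
      have c1 : negMap (fun i : K3Index => (v i : ℝ)) 1 = 0 := by rw [e1]; exact_mod_cast hb
      have c2 : negMap (fun i : K3Index => (v i : ℝ)) 2 = 0 := by rw [e2]; exact_mod_cast hc
      funext k
      fin_cases k
      · simpa using c0
      · simpa using c1
      · simpa using c2
    obtain ⟨hle, hdef⟩ := k3FormR_self_of_mem_ker hmem
    have hne : k3FormR (fun i => (v i : ℝ)) (fun i => (v i : ℝ)) ≠ 0 := by
      intro h0'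
      apply hv0
      ext i
      exact congrFun (eq_zero_of_realCast_eq_zero (hdef h0')) i
    have hlt : k3FormR (fun i => (v i : ℝ)) (fun i => (v i : ℝ)) < 0 := lt_of_le_of_ne hle hne
    rw [← k3FormRat_realCast] at hlt
    exact_mod_cast hlt
  calc 19 ≤ finrank ℚ (LinearMap.ker L) := hker
    _ ≤ sigNeg k3FormRat.toQuadraticMap := le_sigNeg_of_negDef _ hneg

/-! ### The embedding -/

section NS

variable {φ : complexBetti X 2 ≃ₗ[ℂ] (K3HilbertIndex → ℂ)} {P : complexBetti X (2 * 4)} {z : K3HilbertIndex → ℂ}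
  {NQ : Submodule ℚ (K3HilbertIndex → ℚ)}

/-- **Hasse–Minkowski step of `PartnerExistence`: for `ρ(X) ≥ 4` the rational transcendental space
`(T_ℚ, q)` embeds isometrically into `(Λ_{K3} ⊗ ℚ, ( . ))`.**  Both spaces are regular
(`restrict_ratTransc_nondegenerate`, `k3FormRat_nondegenerate`), `dim T_ℚ + 3 = 26 − ρ ≤ 22`,
`ind⁺ T_ℚ ≤ 3 ≤ ind⁺ Λ_ℚ`, `ind⁻ T_ℚ ≤ 23 − ρ ≤ 19 ≤ ind⁻ Λ_ℚ`; apply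
`exists_isometry_of_sigPos_le_of_sigNeg_le_of_finrank_add_three_le`. [cite: Kitaoka1993, Ch. 4 Cor. 4.1.4]
[cite: Morrison1984, §1–2] -/
theorem exists_isometry_ratTransc (hX : IsSmoothProjective 4 X) (hM : MarkedK3Sq[X, φ, P, z])
    (hNQ : ∀ v, v ∈ NQ ↔ φ.symm (fun i => (v i : ℂ)) ∈ algebraicClasses X 1)
    (hρ : 4 ≤ finrank ℂ (algebraicClasses X 1)) :
    ∃ f : ((qQ).restrict ((qQ).orthogonal NQ)).toQuadraticMap →qᵢ k3FormRat.toQuadraticMap,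
      Function.Injective f := by
  obtain ⟨-, hint, -⟩ := id hM
  have hT := finrank_ratTransc hX hint hNQ
  have hρ23 : finrank ℂ (algebraicClasses X 1) ≤ 23 := by
    rw [← finrank_ratNeronSeveri hX hint hNQ, ← finrank_rat23]
    exact Submodule.finrank_le NQ
  have hsymmT : ∀ x y : (qQ).orthogonal NQ,
      (qQ).restrict ((qQ).orthogonal NQ) x y = (qQ).restrict ((qQ).orthogonal NQ) y x :=
    fun x y => qQ_comm _ _
  have hsymmK : ∀ x y : K3Index → ℚ, k3FormRat x y = k3FormRat y x := fun x y => k3FormRat_isSymm.eq x y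
  refine exists_isometry_of_sigPos_le_of_sigNeg_le_of_finrank_add_three_le _ _ ?_ ?_ ?_ ?_ ?_
  · show (QuadraticMap.associatedHom ℚ _).SeparatingLeft
    rw [QuadraticMap.associated_left_inverse ℚ hsymmT]
    exact (restrict_ratTransc_nondegenerate hX hM hNQ).1
  · show (QuadraticMap.associatedHom ℚ _).SeparatingLeft
    rw [QuadraticMap.associated_left_inverse ℚ hsymmK]
    exact k3FormRat_nondegenerate.1
  · rw [hT, finrank_k3Rat]
    omega
  · calc sigPos ((qQ).restrict ((qQ).orthogonal NQ)).toQuadraticMap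
        = sigPos ((qQ).toQuadraticMap.restrict ((qQ).orthogonal NQ)) := by rw [toQuadraticMap_restrict]
      _ ≤ sigPos (qQ).toQuadraticMap := sigPos_restrict_le _ _
      _ ≤ 3 := sigPos_qQ_le_three
      _ ≤ sigPos k3FormRat.toQuadraticMap := three_le_sigPos_k3FormRat
  · calc sigNeg ((qQ).restrict ((qQ).orthogonal NQ)).toQuadraticMap
        ≤ finrank ℚ ((qQ).orthogonal NQ) := sigPos_le_finrank _
      _ ≤ 19 := by rw [hT]; omega
      _ ≤ sigNeg k3FormRat.toQuadraticMap := nineteen_le_sigNeg_k3FormRat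

/-- **An isometry of the quadratic forms is an isometry of the bilinear forms** (polarisation):
`(f t . f t') = q(t, t')`. [folklore] -/
theorem isometry_bilinear (f : ((qQ).restrict ((qQ).orthogonal NQ)).toQuadraticMap →qᵢ k3FormRat.toQuadraticMap)
    (t t' : (qQ).orthogonal NQ) :
    k3FormRat (f t) (f t') = qQ (t : K3HilbertIndex → ℚ) (t' : K3HilbertIndex → ℚ) := by
  have key : k3FormRat (f t) (f t') + k3FormRat (f t') (f t) =
      (qQ).restrict ((qQ).orthogonal NQ) t t' + (qQ).restrict ((qQ).orthogonal NQ) t' t := by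
    rw [← LinearMap.BilinMap.polar_toQuadraticMap, ← LinearMap.BilinMap.polar_toQuadraticMap,
      QuadraticMap.polar, QuadraticMap.polar, ← map_add, f.map_app, f.map_app, f.map_app]
  have h1 : k3FormRat (f t') (f t) = k3FormRat (f t) (f t') := k3FormRat_isSymm.eq (f t') (f t)
  have h2 : (qQ).restrict ((qQ).orthogonal NQ) t' t = (qQ).restrict ((qQ).orthogonal NQ) t t' := qQ_comm _ _
  rw [h1, h2] at key
  have h3 : (qQ).restrict ((qQ).orthogonal NQ) t t' = qQ (t : K3HilbertIndex → ℚ) (t' : K3HilbertIndex → ℚ) :=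
    rfl
  linarith

end NS

end Summit.HodgeConjecture.HodgeConjecture.Theorems.MarkmanPartnerTransport.PartnerLattice

end
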